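import Literature.NumberTheory.GelbartRogawski1991.LocalKudlaSplittingInjectiveTransported
import Literature.RepresentationTheory.MoeglinVignerasWaldspurger1987.RankOneThetaLiftLinesEquivalent
import Summits.HodgeConjecture.CorCM.B01.Transposition.Item6OmegaChiSplitting
import Summits.HodgeConjecture.HodgeCM.CM.Basic
import Summits.HodgeConjecture.HodgeCM.Model.ArchSideTerm
import Literature.NumberTheory.Automorphic.IdeleClassCharacterHecke
import Literature.RepresentationTheory.Liu2021.OscillatorConventions
import Literature.NumberTheory.GelbartRogawski1991.CMSplittingCharLocalMu
import HarnessLib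

/-!
# `hD3` line `a4-liuD3`: Kudla's local injectivity in TRANSPORTED form (`hK` of stubs :190/:195) at a NON-SPLIT place,
# reduced to the line-rigidity identity S6a (cell `hodgecm-mathlib`, binder `HypD3`; crux item stmt-HodgeConjecture-24837)

The closers `muOfIsoNonsplit_of_facts` (:190, `A4LiuD3MuOfIsoNonsplitOfFacts.lean`) and `splitInjective_of_facts` (:195,
`A4LiuD3SplitInjectiveOfFacts.lean`) of line `a4-liuD3` take as an explicit hypothesis, for members `i, j` of the family of
record `famAtV F e₁ dV hdV hdV0 ψ hψ aOf χOf v`, KUDLA'S LOCAL INJECTIVITY IN TRANSPORTED FORM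
`hK i j : (∃ x hx, lineTransportSplitting x (s_i) = s_j) → localMu μ_j v = localMu μ_i v`, where
`s_t := lineTransportSection … (aOf t) v ((chiLocalSplittingsD … μ_t … (aOf t)).s v) _` is member `t`'s `χ`-attached local
splitting of record transported to the line `δ/a_t` model and `lineTransportSplitting x` is B-typ01's line transport
([MoeglinVignerasWaldspurger1987, Chap. 3 IV.4], `RankOneThetaLiftLinesEquivalent.lean`).

This file discharges `hK i j` at a place `v` with `F ⊗ F⁺_v` a field, GIVEN the line-rigidity identity S6a for member `i`'s
character across the two lines (hypothesis `hS6a`, B-p13's `LocalKudlaSplittingRigidity` ∕ `LocalLineIsometryDoubled` chain):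
`∀ x hx, lineTransportSplitting x (s_i) = lineTransportSection … (aOf j) v ((chiLocalSplittingsD … μ_i … (aOf j)).s v) _`.
Proof (`kudla_nonsplit_of_lineRigidity`): `hS6a x hx` and the hypothesis of `hK` have the same left side, so member `j`'s line
carries two equal transported sections, of `μ_i` and of `μ_j`; the transport is injective in the section
(`lineTransportSection_injective`), so the `χ`-attached local splittings of record of `μ_i` and `μ_j` on the line `a_j` have the
same member at `v`; these are the transported undoubled explicit CM packages (`chiLocalSplittingsD` unfolds to
`congrW … (undoubledSplittings … (cmFinLocalFamily …))`), so Kudla's injectivity on those packages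
(`localMu_eq_of_congrW_undoubledSplittings_s_eq`, from `localMu_eq_of_localSplittingCM_eq`, [Kudla1994, §3 Thm. 3.1]) gives
`localMu μ_i v = localMu μ_j v`.

HC_CM is proved only modulo the 7 printed citations (`hDel`, `h21`, `hLiu418`, `h411`, `h413`, `hD3`, `hD1''`) until rung 0 closes;
this file discharges no binder and no interface fact.

## References
* [Kudla1994] S. Kudla, Israel J. Math. 87 (1994), §3 Thm. 3.1.
* [Liu2021] Y. Liu, Camb. J. Math. 9 (2021) = arXiv:2102.11518, App. D Lemma D.1 (3) (l. 5233), proof l. 5249–5255.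
* [MoeglinVignerasWaldspurger1987] MVW, LNM 1291, Chap. 2 II.1, Chap. 3 IV.4.
-/

set_option autoImplicit false

noncomputable section

namespace Summit.HodgeConjecture.CorCM.HypD3
open scoped TensorProduct Matrix
open NumberField NumberField.InfinitePlace
open Literature.NumberTheory.ComplexMultiplication
open Literature.NumberTheory.Automorphic
open Literature.NumberTheory.Automorphic.IdeleClassGroup (toHeckeCharacter isUnitary_toHeckeCharacter)
open Literature.NumberTheory.Automorphic.Liu2021
open HodgeCM.Model.ArchSideTerm (e₁)
open Literature.NumberTheory.GelbartRogawski1991 Literature.NumberTheory.GelbartRogawski1991.UnitaryDualPair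
open Literature.NumberTheory.GelbartRogawski1991.UnitaryDualPair.LocalSplitting (localMu norm_localMu continuous_localMu
  localMu_toLocalRing_eq_one_iff lineTransportSection conj_lineDelta lineDelta_ne_zero lineDelta_mul_self)
open Literature.RepresentationTheory Literature.RepresentationTheory.Liu2021
open Literature.RepresentationTheory.MoeglinVignerasWaldspurger1987 (lineTransportSplitting)
open Summit.HodgeConjecture.CorCM.Transposition

open Literature.NumberTheory.GelbartRogawski1991.GRConstruction (localMu_eq_of_congrW_undoubledSplittings_s_eq)
open Literature.NumberTheory.GelbartRogawski1991.UnitaryDualPair.LocalSplitting (lineTransportSection_injective)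

-- heartbeats: elaborating the spelled `hK`/`hS6a` binders alone exceeds the default budget (whnf/isDefEq on the packaged CM
-- sections), as in `A4LiuD3SplitInjectiveOfFacts.lean` / `A4LiuD3MuOfIsoNonsplitOfFacts.lean`; the proof is five short steps.
set_option maxHeartbeats 1600000 in
/-- **Kudla's local injectivity in transported form (`hK i j` of stubs :190/:195) at a non-split place, from the line-rigidity
identity S6a for member `i`'s character** (hypothesis `hS6a`): for every CM field `F`, real frame `dV`, index maps `ψ, hψ, aOf`,
finite place `v` of `F⁺` with `F ⊗ F⁺_v` a field and members `i, j`,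
`(∀ x hx, lineTransportSplitting x (s_i) = s^{μ_i}_{a_j}) → ((∃ x hx, lineTransportSplitting x (s_i) = s_j) → localMu μ_j v = localMu μ_i v)`.
[cite: Kudla1994, §3 Thm. 3.1] [cite: Liu2021, App. D Lemma D.1 (3) (l. 5233), proof l. 5255]
[cite: MoeglinVignerasWaldspurger1987, Chap. 2 II.1, Chap. 3 IV.4] -/
theorem kudla_nonsplit_of_lineRigidity :
    ∀ (F : HodgeCM.CMField) (dV : Fin 3 → (F : Type))
      (hdV : ∀ i, IsCMField.complexConj (F : Type) (dV i) = dV i) (hdV0 : ∀ i, dV i ≠ 0) {ι : Type}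
      (ψ : ι → (Literature.NumberTheory.Automorphic.IdeleClassGroup (F : Type) →ₜ* Circle))
      (hψ : ∀ t, IdeleClassGroup.IsConjugateSymplectic (F : Type) (ψ t))
      (aOf : ι → (↥(maximalRealSubfield (F : Type)))ˣ)
      (v : IsDedekindDomain.HeightOneSpectrum (𝓞 ↥(maximalRealSubfield (F : Type)))),
      IsField (UnitaryGroup.LocalRing (F : Type) v) →
      ∀ i j : ι,
        (∀ (x : (UnitaryGroup.LocalRing (F : Type) v)ˣ) (hx : algebraMap (F : Type) (UnitaryGroup.LocalRing (F : Type) v) (algebraMap ↥(maximalRealSubfield (F : Type)) (F : Type) (↑(aOf j)⁻¹ : ↥(maximalRealSubfield (F : Type))) * imagUnit (F : Type)) =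
            (x : (UnitaryGroup.LocalRing (F : Type) v)) * UnitaryGroup.conjLocal (F : Type) (IsCMField.complexConj (F : Type)) v x * algebraMap (F : Type) (UnitaryGroup.LocalRing (F : Type) v) (algebraMap ↥(maximalRealSubfield (F : Type)) (F : Type) (↑(aOf i)⁻¹ : ↥(maximalRealSubfield (F : Type))) * imagUnit (F : Type))),
          lineTransportSplitting (F : Type) v (IsCMField.complexConj (F : Type)) 3 (conj_lineDelta (complexConj_imagUnit (F : Type)) (aOf i)) (lineDelta_ne_zero (imagUnit_ne_zero (F : Type)) (aOf i))
            (lineDelta_mul_self (imagUnit_mul_self (F : Type)) (aOf i)) (conj_lineDelta (complexConj_imagUnit (F : Type)) (aOf j)) (lineDelta_ne_zero (imagUnit_ne_zero (F : Type)) (aOf j))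
            (lineDelta_mul_self (imagUnit_mul_self (F : Type)) (aOf j)) x (realDiagonal (F : Type) dV hdV) (realDiagonal_isSymm (F : Type) dV hdV) (isUnit_det_realDiagonal (F : Type) dV hdV hdV0) hx
            (lineTransportSection ↥(maximalRealSubfield (F : Type)) (F : Type) (IsCMField.complexConj (F : Type)) 3 (complexConj_imagUnit (F : Type)) (imagUnit_ne_zero (F : Type)) (imagUnit_mul_self (F : Type)) (realDiagonal (F : Type) dV hdV) (realDiagonal_isSymm (F : Type) dV hdV) (Matrix.diagonal dV) (realDiagonal_map (F : Type) dV hdV).symm (aOf i) v ((OmegaChiSplitting.chiLocalSplittingsD ⟨HodgeCM.CMField.K F⟩ e₁ dV hdV hdV0 (toHeckeCharacter (F : Type) (ψ i)) ((isOscillatorChar_toHeckeCharacter_iff (ψ i)).mpr (hψ i)) (aOf i)).s v) ((OmegaChiSplitting.chiLocalSplittingsD ⟨HodgeCM.CMField.K F⟩ e₁ dV hdV hdV0 (toHeckeCharacter (F : Type) (ψ i)) ((isOscillatorChar_toHeckeCharacter_iff (ψ i)).mpr (hψ i)) (aOf i)).proj_s v)) =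
          (lineTransportSection ↥(maximalRealSubfield (F : Type)) (F : Type) (IsCMField.complexConj (F : Type)) 3 (complexConj_imagUnit (F : Type)) (imagUnit_ne_zero (F : Type)) (imagUnit_mul_self (F : Type)) (realDiagonal (F : Type) dV hdV) (realDiagonal_isSymm (F : Type) dV hdV) (Matrix.diagonal dV) (realDiagonal_map (F : Type) dV hdV).symm (aOf j) v ((OmegaChiSplitting.chiLocalSplittingsD ⟨HodgeCM.CMField.K F⟩ e₁ dV hdV hdV0 (toHeckeCharacter (F : Type) (ψ i)) ((isOscillatorChar_toHeckeCharacter_iff (ψ i)).mpr (hψ i)) (aOf j)).s v) ((OmegaChiSplitting.chiLocalSplittingsD ⟨HodgeCM.CMField.K F⟩ e₁ dV hdV hdV0 (toHeckeCharacter (F : Type) (ψ i)) ((isOscillatorChar_toHeckeCharacter_iff (ψ i)).mpr (hψ i)) (aOf j)).proj_s v))) →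
        (∃ (x : (UnitaryGroup.LocalRing (F : Type) v)ˣ) (hx : algebraMap (F : Type) (UnitaryGroup.LocalRing (F : Type) v) (algebraMap ↥(maximalRealSubfield (F : Type)) (F : Type) (↑(aOf j)⁻¹ : ↥(maximalRealSubfield (F : Type))) * imagUnit (F : Type)) =
            (x : (UnitaryGroup.LocalRing (F : Type) v)) * UnitaryGroup.conjLocal (F : Type) (IsCMField.complexConj (F : Type)) v x * algebraMap (F : Type) (UnitaryGroup.LocalRing (F : Type) v) (algebraMap ↥(maximalRealSubfield (F : Type)) (F : Type) (↑(aOf i)⁻¹ : ↥(maximalRealSubfield (F : Type))) * imagUnit (F : Type))),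
          lineTransportSplitting (F : Type) v (IsCMField.complexConj (F : Type)) 3 (conj_lineDelta (complexConj_imagUnit (F : Type)) (aOf i)) (lineDelta_ne_zero (imagUnit_ne_zero (F : Type)) (aOf i))
            (lineDelta_mul_self (imagUnit_mul_self (F : Type)) (aOf i)) (conj_lineDelta (complexConj_imagUnit (F : Type)) (aOf j)) (lineDelta_ne_zero (imagUnit_ne_zero (F : Type)) (aOf j))
            (lineDelta_mul_self (imagUnit_mul_self (F : Type)) (aOf j)) x (realDiagonal (F : Type) dV hdV) (realDiagonal_isSymm (F : Type) dV hdV) (isUnit_det_realDiagonal (F : Type) dV hdV hdV0) hx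
            (lineTransportSection ↥(maximalRealSubfield (F : Type)) (F : Type) (IsCMField.complexConj (F : Type)) 3 (complexConj_imagUnit (F : Type)) (imagUnit_ne_zero (F : Type)) (imagUnit_mul_self (F : Type)) (realDiagonal (F : Type) dV hdV) (realDiagonal_isSymm (F : Type) dV hdV) (Matrix.diagonal dV) (realDiagonal_map (F : Type) dV hdV).symm (aOf i) v ((OmegaChiSplitting.chiLocalSplittingsD ⟨HodgeCM.CMField.K F⟩ e₁ dV hdV hdV0 (toHeckeCharacter (F : Type) (ψ i)) ((isOscillatorChar_toHeckeCharacter_iff (ψ i)).mpr (hψ i)) (aOf i)).s v) ((OmegaChiSplitting.chiLocalSplittingsD ⟨HodgeCM.CMField.K F⟩ e₁ dV hdV hdV0 (toHeckeCharacter (F : Type) (ψ i)) ((isOscillatorChar_toHeckeCharacter_iff (ψ i)).mpr (hψ i)) (aOf i)).proj_s v)) =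
          (lineTransportSection ↥(maximalRealSubfield (F : Type)) (F : Type) (IsCMField.complexConj (F : Type)) 3 (complexConj_imagUnit (F : Type)) (imagUnit_ne_zero (F : Type)) (imagUnit_mul_self (F : Type)) (realDiagonal (F : Type) dV hdV) (realDiagonal_isSymm (F : Type) dV hdV) (Matrix.diagonal dV) (realDiagonal_map (F : Type) dV hdV).symm (aOf j) v ((OmegaChiSplitting.chiLocalSplittingsD ⟨HodgeCM.CMField.K F⟩ e₁ dV hdV hdV0 (toHeckeCharacter (F : Type) (ψ j)) ((isOscillatorChar_toHeckeCharacter_iff (ψ j)).mpr (hψ j)) (aOf j)).s v) ((OmegaChiSplitting.chiLocalSplittingsD ⟨HodgeCM.CMField.K F⟩ e₁ dV hdV hdV0 (toHeckeCharacter (F : Type) (ψ j)) ((isOscillatorChar_toHeckeCharacter_iff (ψ j)).mpr (hψ j)) (aOf j)).proj_s v))) →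
        localMu (F : Type) (toHeckeCharacter (F : Type) (ψ j)) v = localMu (F : Type) (toHeckeCharacter (F : Type) (ψ i)) v := by
  intro F dV hdV hdV0 ι ψ hψ aOf v hE i j hS6a
  rintro ⟨x, hx, htr⟩
  have h1 := (hS6a x hx).symm.trans htr
  have h2 := lineTransportSection_injective ↥(maximalRealSubfield (F : Type)) (F : Type) (IsCMField.complexConj (F : Type)) 3
    (complexConj_imagUnit (F : Type)) (imagUnit_ne_zero (F : Type)) (imagUnit_mul_self (F : Type)) (realDiagonal (F : Type) dV hdV)
    (realDiagonal_isSymm (F : Type) dV hdV) (Matrix.diagonal dV) (realDiagonal_map (F : Type) dV hdV).symm (aOf j) v _ _ _ _ h1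
  have h3 : localMu (F : Type) (toHeckeCharacter (F : Type) (ψ i)) v = localMu (F : Type) (toHeckeCharacter (F : Type) (ψ j)) v :=
    localMu_eq_of_congrW_undoubledSplittings_s_eq (F : Type) e₁ dV hdV hdV0 _ _ _ _ _ _ _
      (toHeckeCharacter (F : Type) (ψ i)) (toHeckeCharacter (F : Type) (ψ j)) _ _ v hE h2
  exact h3.symm

end Summit.HodgeConjecture.CorCM.HypD3

end
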